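import Summits.KontsevichZagierPeriods.KontsevichZagierPeriods.Theorems.AbelContractionRealHyperellipticSectorStubEuler

/-!
# Route AbelContraction — `RealHyperellipticSector` (crux stmt-KontsevichZagierPeriods-12475): the transport kit

Helper file of the line `Lines/birth.lean` (registered brick `transport_arcs` of the stub
`stub_complete`, `--supports` the crux): the bookkeeping behind the Möbius transport of the arc
generators `[S, (A + B√q)/D]` (`S ⊆ {q > 0, D ≠ 0}` an open interval, `A B D ∈ ℚ[X]`) of the
sector of `q ∈ ℚ[X]` to the arc generators of another model `q'` by ONE move of rule (2) inside
dimension one. Contents: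

* the closure properties of *`ℚ`-rational functions on a set `T ⊆ ℝ`* — real functions equal on
  `T` to a quotient `P/Q`, `P Q ∈ ℚ[X]`, `Q ≠ 0` on `T` — under rational constants, the
  coordinate, `+`, `*`, `⁻¹`, `/`, powers and substitution into a `ℚ`-polynomial
  (`Transport.qrat_*`, the `ℚ`-version of the `K`-rational kit `Euler.krat_*`; the predicate is
  kept INLINE as `∃ P Q, ∀ t ∈ T, Q(t) ≠ 0 ∧ f t = P(t)/Q(t)`, no definition is introduced);
* `Transport.arcShape_of_qrat`: `α + β·w` with `α, β` `ℚ`-rational on `T` has the arc shape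
  `(A″ + B″·w)/D″` on `T` (`A″ B″ D″ ∈ ℚ[X]`, `D″ ≠ 0` on `T`);
* `Transport.exists_arc_of_subst`: **one rule-(2) move from an arc to an arc** — if `φ` is
  `ℚ`-semialgebraic on the slab of `S` with `ℚ`-semialgebraic nowhere-zero derivative `φ'` on `S`,
  `ψ` is a `ℚ`-semialgebraic left inverse of `φ` on `S`, and the pushed-forward integrand
  `f(x)/|φ'(x)| = F(φ x)` has the arc shape `(A″ + B″√q')/D″` of the sector of `q'` on
  `T = φ(S) ⊆ {q' > 0, D″ ≠ 0}`, then `[r] − [T, F] ∈ KZ.relationsLE 1` with `[T, F] ∈ arcs q'`: the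
  push-forward `stub_pushforwardDimOne` (tree, `HermiteRigidityGenusTwoCycleTransferPushforwardDimOne`)
  supplies the `KZ.changeOfVariablesRel` instance, which lies in `KZ.movesLE 1` as both
  representations have dimension `1`; `T` is an open interval as the continuous injective image
  of `S` (`Euler.isOpen_image_of_injOn`, `Euler.ordConnected_image`).

References: M. Kontsevich, D. Zagier, *Periods* (2001), §1.2 rule (2) [KontsevichZagier2001];
J. Bochnak, M. Coste, M.-F. Roy, *Real Algebraic Geometry* (1998), §2.2 (Prop. 2.2.6–2.2.7)
[BochnakCosteRoy1998]. No definitions are introduced.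
-/

noncomputable section

open Set MeasureTheory
open scoped Polynomial
open Literature.ModelTheory.ExponentialFields (IsSemialgebraic)
open Literature.NumberTheory.Transcendental Literature.NumberTheory.Transcendental.KZ
open Summit.KontsevichZagierPeriods.HermiteRigidity.GenusTwoCycleTransfer (stub_pushforwardDimOne)

namespace Summit.KontsevichZagierPeriods.AbelContraction.RealHyperellipticSector

namespace Transport

variable {T : Set ℝ} {f g : ℝ → ℝ}

/-! ## `ℚ`-rational functions on a set of reals

A real function `f` is *`ℚ`-rational on `T ⊆ ℝ`* if `f = P/Q` on `T` for some `P Q ∈ ℚ[X]` with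
`Q ≠ 0` on `T`. The predicate is kept inline (`∃ P Q, ∀ t ∈ T, Q(t) ≠ 0 ∧ f t = P(t)/Q(t)`); no
definition is introduced. -/

/-- A rational constant is `ℚ`-rational. [folklore] -/
theorem qrat_const (T : Set ℝ) (c : ℚ) :
    ∃ P Q : ℚ[X], ∀ t ∈ T, (Polynomial.aeval t Q : ℝ) ≠ 0 ∧
      (fun _ : ℝ => (c : ℝ)) t = (Polynomial.aeval t P : ℝ) / (Polynomial.aeval t Q : ℝ) :=
  ⟨Polynomial.C c, 1, fun t _ => ⟨by simp, by simp⟩⟩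

/-- The coordinate is `ℚ`-rational. [folklore] -/
theorem qrat_id (T : Set ℝ) :
    ∃ P Q : ℚ[X], ∀ t ∈ T, (Polynomial.aeval t Q : ℝ) ≠ 0 ∧
      (fun s : ℝ => s) t = (Polynomial.aeval t P : ℝ) / (Polynomial.aeval t Q : ℝ) :=
  ⟨Polynomial.X, 1, fun t _ => ⟨by simp, by simp⟩⟩

/-- `ℚ`-rationality only depends on the values on `T`. [folklore] -/
theorem qrat_congr
    (hf : ∃ P Q : ℚ[X], ∀ t ∈ T, (Polynomial.aeval t Q : ℝ) ≠ 0 ∧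
      f t = (Polynomial.aeval t P : ℝ) / (Polynomial.aeval t Q : ℝ))
    (h : ∀ t ∈ T, f t = g t) :
    ∃ P Q : ℚ[X], ∀ t ∈ T, (Polynomial.aeval t Q : ℝ) ≠ 0 ∧
      g t = (Polynomial.aeval t P : ℝ) / (Polynomial.aeval t Q : ℝ) := by
  obtain ⟨P, Q, hPQ⟩ := hf
  exact ⟨P, Q, fun t ht => ⟨(hPQ t ht).1, (h t ht) ▸ (hPQ t ht).2⟩⟩

/-- Sums of `ℚ`-rational functions are `ℚ`-rational. [folklore] -/
theorem qrat_add
    (hf : ∃ P Q : ℚ[X], ∀ t ∈ T, (Polynomial.aeval t Q : ℝ) ≠ 0 ∧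
      f t = (Polynomial.aeval t P : ℝ) / (Polynomial.aeval t Q : ℝ))
    (hg : ∃ P Q : ℚ[X], ∀ t ∈ T, (Polynomial.aeval t Q : ℝ) ≠ 0 ∧
      g t = (Polynomial.aeval t P : ℝ) / (Polynomial.aeval t Q : ℝ)) :
    ∃ P Q : ℚ[X], ∀ t ∈ T, (Polynomial.aeval t Q : ℝ) ≠ 0 ∧
      (fun s => f s + g s) t = (Polynomial.aeval t P : ℝ) / (Polynomial.aeval t Q : ℝ) := by
  obtain ⟨P₁, Q₁, h₁⟩ := hf
  obtain ⟨P₂, Q₂, h₂⟩ := hg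
  refine ⟨P₁ * Q₂ + P₂ * Q₁, Q₁ * Q₂, fun t ht => ?_⟩
  obtain ⟨hq₁, hf₁⟩ := h₁ t ht
  obtain ⟨hq₂, hf₂⟩ := h₂ t ht
  refine ⟨by simpa [map_mul] using mul_ne_zero hq₁ hq₂, ?_⟩
  simp only [map_add, map_mul, hf₁, hf₂]
  field_simp

/-- Products of `ℚ`-rational functions are `ℚ`-rational. [folklore] -/
theorem qrat_mul
    (hf : ∃ P Q : ℚ[X], ∀ t ∈ T, (Polynomial.aeval t Q : ℝ) ≠ 0 ∧
      f t = (Polynomial.aeval t P : ℝ) / (Polynomial.aeval t Q : ℝ))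
    (hg : ∃ P Q : ℚ[X], ∀ t ∈ T, (Polynomial.aeval t Q : ℝ) ≠ 0 ∧
      g t = (Polynomial.aeval t P : ℝ) / (Polynomial.aeval t Q : ℝ)) :
    ∃ P Q : ℚ[X], ∀ t ∈ T, (Polynomial.aeval t Q : ℝ) ≠ 0 ∧
      (fun s => f s * g s) t = (Polynomial.aeval t P : ℝ) / (Polynomial.aeval t Q : ℝ) := by
  obtain ⟨P₁, Q₁, h₁⟩ := hf
  obtain ⟨P₂, Q₂, h₂⟩ := hg
  refine ⟨P₁ * P₂, Q₁ * Q₂, fun t ht => ?_⟩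
  obtain ⟨hq₁, hf₁⟩ := h₁ t ht
  obtain ⟨hq₂, hf₂⟩ := h₂ t ht
  refine ⟨by simpa [map_mul] using mul_ne_zero hq₁ hq₂, ?_⟩
  simp only [map_mul, hf₁, hf₂]
  field_simp

/-- Inverses of non-vanishing `ℚ`-rational functions are `ℚ`-rational. [folklore] -/
theorem qrat_inv
    (hf : ∃ P Q : ℚ[X], ∀ t ∈ T, (Polynomial.aeval t Q : ℝ) ≠ 0 ∧
      f t = (Polynomial.aeval t P : ℝ) / (Polynomial.aeval t Q : ℝ))
    (h0 : ∀ t ∈ T, f t ≠ 0) :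
    ∃ P Q : ℚ[X], ∀ t ∈ T, (Polynomial.aeval t Q : ℝ) ≠ 0 ∧
      (fun s => (f s)⁻¹) t = (Polynomial.aeval t P : ℝ) / (Polynomial.aeval t Q : ℝ) := by
  obtain ⟨P, Q, hPQ⟩ := hf
  refine ⟨Q, P, fun t ht => ?_⟩
  obtain ⟨hq, hft⟩ := hPQ t ht
  have hp : (Polynomial.aeval t P : ℝ) ≠ 0 := by
    intro hp
    exact h0 t ht (by rw [hft, hp, zero_div])
  exact ⟨hp, by show (f t)⁻¹ = _; rw [hft, inv_div]⟩

/-- Quotients of `ℚ`-rational functions (denominator non-vanishing) are `ℚ`-rational. [folklore] -/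
theorem qrat_div
    (hf : ∃ P Q : ℚ[X], ∀ t ∈ T, (Polynomial.aeval t Q : ℝ) ≠ 0 ∧
      f t = (Polynomial.aeval t P : ℝ) / (Polynomial.aeval t Q : ℝ))
    (hg : ∃ P Q : ℚ[X], ∀ t ∈ T, (Polynomial.aeval t Q : ℝ) ≠ 0 ∧
      g t = (Polynomial.aeval t P : ℝ) / (Polynomial.aeval t Q : ℝ))
    (h0 : ∀ t ∈ T, g t ≠ 0) :
    ∃ P Q : ℚ[X], ∀ t ∈ T, (Polynomial.aeval t Q : ℝ) ≠ 0 ∧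
      (fun s => f s / g s) t = (Polynomial.aeval t P : ℝ) / (Polynomial.aeval t Q : ℝ) :=
  qrat_congr (qrat_mul hf (qrat_inv hg h0)) fun t _ => by simp [div_eq_mul_inv]

/-- Powers of `ℚ`-rational functions are `ℚ`-rational. [folklore] -/
theorem qrat_pow
    (hf : ∃ P Q : ℚ[X], ∀ t ∈ T, (Polynomial.aeval t Q : ℝ) ≠ 0 ∧
      f t = (Polynomial.aeval t P : ℝ) / (Polynomial.aeval t Q : ℝ)) (n : ℕ) :
    ∃ P Q : ℚ[X], ∀ t ∈ T, (Polynomial.aeval t Q : ℝ) ≠ 0 ∧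
      (fun s => f s ^ n) t = (Polynomial.aeval t P : ℝ) / (Polynomial.aeval t Q : ℝ) := by
  induction n with
  | zero => exact qrat_congr (qrat_const T 1) fun t _ => by simp
  | succ n ih => exact qrat_congr (qrat_mul ih hf) fun t _ => by simp [pow_succ]

/-- A `ℚ`-polynomial of a `ℚ`-rational function is `ℚ`-rational. [folklore] -/
theorem qrat_aeval (A : ℚ[X])
    (hf : ∃ P Q : ℚ[X], ∀ t ∈ T, (Polynomial.aeval t Q : ℝ) ≠ 0 ∧
      f t = (Polynomial.aeval t P : ℝ) / (Polynomial.aeval t Q : ℝ)) :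
    ∃ P Q : ℚ[X], ∀ t ∈ T, (Polynomial.aeval t Q : ℝ) ≠ 0 ∧
      (fun s => (Polynomial.aeval (f s) A : ℝ)) t =
        (Polynomial.aeval t P : ℝ) / (Polynomial.aeval t Q : ℝ) := by
  induction A using Polynomial.induction_on' with
  | add p q hp hq => exact qrat_congr (qrat_add hp hq) fun t _ => by simp
  | monomial n a =>
    refine qrat_congr (qrat_mul (qrat_const T a) (qrat_pow hf n)) fun t _ => ?_
    simp [Polynomial.aeval_monomial]

/-- **The arc shape from `ℚ`-rational coefficients**: if `α` and `β` are `ℚ`-rational on `T` then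
`α + β·w = (A″ + B″·w)/D″` on `T` for some `A″ B″ D″ ∈ ℚ[X]` with `D″ ≠ 0` on `T` (common
denominator). [folklore] -/
theorem arcShape_of_qrat {α β : ℝ → ℝ} (w : ℝ → ℝ)
    (hα : ∃ P Q : ℚ[X], ∀ t ∈ T, (Polynomial.aeval t Q : ℝ) ≠ 0 ∧
      α t = (Polynomial.aeval t P : ℝ) / (Polynomial.aeval t Q : ℝ))
    (hβ : ∃ P Q : ℚ[X], ∀ t ∈ T, (Polynomial.aeval t Q : ℝ) ≠ 0 ∧
      β t = (Polynomial.aeval t P : ℝ) / (Polynomial.aeval t Q : ℝ)) :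
    ∃ A B D : ℚ[X], ∀ t ∈ T, (Polynomial.aeval t D : ℝ) ≠ 0 ∧
      α t + β t * w t = ((Polynomial.aeval t A : ℝ) + (Polynomial.aeval t B : ℝ) * w t) /
        (Polynomial.aeval t D : ℝ) := by
  obtain ⟨P₁, Q₁, h₁⟩ := hα
  obtain ⟨P₂, Q₂, h₂⟩ := hβ
  refine ⟨P₁ * Q₂, P₂ * Q₁, Q₁ * Q₂, fun t ht => ?_⟩
  obtain ⟨hq₁, hf₁⟩ := h₁ t ht
  obtain ⟨hq₂, hf₂⟩ := h₂ t ht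
  refine ⟨by simpa [map_mul] using mul_ne_zero hq₁ hq₂, ?_⟩
  simp only [map_mul, hf₁, hf₂]
  field_simp

/-! ## One rule-(2) move from an arc to an arc -/

/-- **Substitution to an arc of another model (one move of rule (2) inside dimension one).**
Let `r` be a one-dimensional representation over the slab of an open order-connected `S ⊆ ℝ`,
`φ` a `ℚ`-semialgebraic function of the coordinate with `ℚ`-semialgebraic nowhere-zero derivative
`φ'` on `S`, `ψ` a `ℚ`-semialgebraic function of the line with `ψ (φ x) = x` on `S`, and suppose
the pushed-forward integrand has the arc shape of the sector of `q'` on `T = φ(S)`: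
`f(x)/|φ'(x)| = F(φ x)` on the slab with `F = (A″ + B″√q')/D″` on `T ⊆ {q' > 0, D″ ≠ 0}`,
`A″ B″ D″ ∈ ℚ[X]`. Then `[r] − x' ∈ KZ.relationsLE 1` for some `x' ∈ arcs q'`, namely
`x' = [T, F]` (`stub_pushforwardDimOne`; `T` is open and order-connected as the continuous
injective image of `S`). [cite: KontsevichZagier2001, §1.2 rule (2)] -/
theorem exists_arc_of_subst : ∀ (q' : Polynomial ℚ) (r : KZ.IntegralRep 1) (S : Set ℝ), IsOpen S →
    S.OrdConnected → r.domain = {p | p 0 ∈ S} → ∀ (φ φ' ψ F : ℝ → ℝ),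
    IsSemialgebraicFunOn ℚ r.domain (fun p => φ (p 0)) →
    IsSemialgebraicFunOn ℚ r.domain (fun p => φ' (p 0)) →
    (∀ x ∈ S, HasDerivAt φ (φ' x) x) → (∀ x ∈ S, φ' x ≠ 0) →
    IsSemialgebraicFunOn ℚ (Set.univ : Set (Fin 1 → ℝ)) (fun p => ψ (p 0)) →
    (∀ x ∈ S, ψ (φ x) = x) → (∀ t ∈ φ '' S, 0 < Polynomial.aeval t q') →
    (∃ A B D : Polynomial ℚ, ∀ t ∈ φ '' S, Polynomial.aeval t D ≠ 0 ∧
      F t = (Polynomial.aeval t A + Polynomial.aeval t B * Real.sqrt (Polynomial.aeval t q')) /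
        Polynomial.aeval t D) →
    (∀ p ∈ r.domain, r.integrand p / |φ' (p 0)| = F (φ (p 0))) →
    ∃ x' ∈ arcs q', KZ.of r - x' ∈ KZ.relationsLE 1 := by
  intro q' r S hS hSo hdom φ φ' ψ F hφ hφ' hder hne hψ hψφ hpos hF hFφ
  have hmem : ∀ p, p ∈ r.domain ↔ p 0 ∈ S := fun p => by rw [hdom]; rfl
  have heq : ∀ p : Fin 1 → ℝ, (fun _ : Fin 1 => p 0) = p := fun p => by
    funext i
    rw [Fin.fin_one_eq_zero i]
  -- the image slab
  have himg : (fun p : Fin 1 → ℝ => fun _ : Fin 1 => φ (p 0)) '' r.domain =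
      {p | p 0 ∈ φ '' S} := by
    ext p'
    simp only [mem_image, mem_setOf_eq]
    constructor
    · rintro ⟨p, hp, rfl⟩
      exact ⟨p 0, (hmem p).1 hp, rfl⟩
    · rintro ⟨x, hx, hx'⟩
      refine ⟨fun _ => x, (hmem _).2 hx, ?_⟩
      rw [← heq p']
      funext i
      exact hx'
  have hΦsa : IsSemialgebraicMapOn ℚ r.domain (fun p : Fin 1 → ℝ => fun _ : Fin 1 => φ (p 0)) :=
    IsSemialgebraicMapOn.of_forall r.isSemialgebraic_domain fun _ => hφ
  have hT : IsSemialgebraic ℚ ((fun p : Fin 1 → ℝ => fun _ : Fin 1 => φ (p 0)) '' r.domain) :=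
    IsSemialgebraicMapOn.isSemialgebraic_image_holds hΦsa subset_rfl r.isSemialgebraic_domain
  -- the inverse chart
  have hG : IsSemialgebraicMapOn ℚ ((fun p : Fin 1 → ℝ => fun _ : Fin 1 => φ (p 0)) '' r.domain)
      (fun (p : Fin 1 → ℝ) (_ : Fin 1) => ψ (p 0)) :=
    IsSemialgebraicMapOn.of_forall hT fun _ => hψ.mono (subset_univ _) hT
  have hGφ : ∀ p ∈ r.domain, (fun _ : Fin 1 => ψ ((fun _ : Fin 1 => φ (p 0)) 0)) = p := by
    intro p hp
    rw [← heq p]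
    funext
    exact hψφ _ ((hmem p).1 hp)
  obtain ⟨s, hsd, hsi, hcv⟩ := stub_pushforwardDimOne r φ φ'
    (fun (p : Fin 1 → ℝ) (_ : Fin 1) => ψ (p 0)) hφ hφ'
    (fun p hp => hder _ ((hmem p).1 hp)) (fun p hp => hne _ ((hmem p).1 hp)) hG hGφ
  have hcont : ContinuousOn φ S := fun x hx => (hder x hx).continuousAt.continuousWithinAt
  have hinj : InjOn φ S := fun x hx y hy h => by rw [← hψφ x hx, ← hψφ y hy, h]
  obtain ⟨A, B, D, hABD⟩ := hF
  have hsd' : s.domain = {p | p 0 ∈ φ '' S} := by rw [hsd, himg]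
  have hmem' : ∀ p, p ∈ s.domain ↔ p 0 ∈ φ '' S := fun p => by rw [hsd']; rfl
  refine ⟨of s, ⟨s, A, B, D, φ '' S, Euler.isOpen_image_of_injOn hS hcont hinj,
    Euler.ordConnected_image hSo hcont, hsd', fun p hp => ?_, ?_, rfl⟩, ?_⟩
  · exact ⟨hpos _ ((hmem' p).1 hp), (hABD _ ((hmem' p).1 hp)).1⟩
  · intro p' hp'
    rw [hsd] at hp'
    obtain ⟨p, hp, rfl⟩ := hp'
    rw [hsi p hp, hFφ p hp]
    exact (hABD _ ⟨p 0, (hmem p).1 hp, rfl⟩).2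
  · exact movesLE_subset_relationsLE 1 ⟨Or.inl (Or.inr hcv),
      sub_mem (of_mem_formalRepLE r le_rfl) (of_mem_formalRepLE s le_rfl)⟩

end Transport

end Summit.KontsevichZagierPeriods.AbelContraction.RealHyperellipticSector

end
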